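import Literature.MathematicalPhysics.QuantumLattice.HubbardTTPrimeFreeKineticBound
import HarnessLib

/-!
# `t–t'` Hubbard model: the next-nearest-neighbour hopping amplitude as a supergradient in `t'`
# (joint concavity of `(t', U) ↦ E_N(t, t', U)`; Hellmann–Feynman bookkeeping)

Companion of `HubbardTTPrimeFreeKineticBound.lean` (the `U`-direction: double occupancy `⟨D⟩` as a
supergradient of `U ↦ E_N`).  Here the SECOND linear parameter of the `t–t'–U` Hamiltonian
`H(t,t',U) = -t T - t' T' + U D` (Xu et al. 2024, eq. (1)) is exploited: with the diagonal
(next-nearest-neighbour) hopping operator `T' = Σ_σ Σ_{x ∼' y} c†_{xσ} c_{yσ}` (both orderings of each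
diagonal bond; `diagHop`), the map `(t', U) ↦ H(t,t',U)` is affine,
`H(t,t₂',U₂) = H(t,t',U) + (t' - t₂') T' + (U₂ - U) D` (`hubbardTorusTT'_eq_add_smul_add_smul`),
so the sector ground energy `E_N(t,·,·)` is jointly concave and, for every normalised ground state
`ψ` of `H(t,t',U)`, the pair `(-Re⟨ψ,T'ψ⟩, ⟨ψ,Dψ⟩)` is a supergradient (variational principle at the
second point — Griffiths' / Koma–Tasaki's concavity argument, `KomaTasaki1994` §1, written for two
parameters):

`E_N(t,t₂',U₂) ≤ E_N(t,t',U) + (t' - t₂')·Re⟨ψ,T'ψ⟩ + (U₂ - U)·⟨ψ,Dψ⟩`   (`groundEnergy_tt_le_affine`).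

Consequences packaged for certified-number rows (all hypotheses are plain energy bounds):
* `diagHop_le_of_bounds` / `le_diagHop_of_bounds` — one-sided brackets on the diagonal hopping
  amplitude `Re⟨ψ,T'ψ⟩` of a ground state at `t'` from an upper bound at `t'` and a lower bound at a
  second `t₂' > t'` (resp. `t₂' < t'`), same `U`;
* `joint_le_of_bounds` — the supporting half-plane
  `(t₂' - t')·Re⟨ψ,T'ψ⟩ + (U - U₂)·⟨ψ,Dψ⟩ ≤ R - L₂` of the `(T', D)` region from an upper bound `R` at
  `(t',U)` and a lower bound `L₂` at any second point `(t₂',U₂)`;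
* `re_expect_tt_zero_split` — the kinetic bookkeeping `Re⟨ψ,H(t,t',0)ψ⟩ = Re⟨ψ,H(t,0,0)ψ⟩ - t'·Re⟨ψ,T'ψ⟩`;
* `groundEnergy_hubbardTorusTT'_tzero` — at `t₂' = 0` the second point is the tree's pure Hubbard object
  `groundEnergyAt (fermionTorusGraph 2 L) t U N` (so `t' = 0` certificates serve as second points);
* the a-priori range on the `4 × 4` torus, `-16 ≤ Re⟨ψ,T'ψ⟩ ≤ 16` for every normalised `N`-particle
  state (`abs_diagHop_four_le`: the free `t = 0, t' = ∓1` floors of `le_groundEnergy_hubbardTorusTT'`,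
  i.e. the sixteen diagonal-band levels `4 cos k₁ cos k₂ ∈ {±4 (×2 each), 0 (×12)}` per spin).

Cell use (pub-hubbard R2, device D23): certified ceilings on the next-nearest-neighbour hopping amplitude
per site of the `4 × 4`, `U = 8`, `t' ∈ {-1/4, -1/5}` ground states from the cell's `t'` energy nodes
and its `t' = 0` lower nodes, a floor at `t' = 0`, `N = 14`, and the joint `(T', D)` half-planes.
HONEST FRAMING (cell pub-hubbard): ladder R1–R4 with certified numbers; no claim on H/H₀.

References: T. Koma, H. Tasaki, Commun. Math. Phys. 158 (1993) 191, §1 (concavity of the ground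
energy in a coupling, Hellmann–Feynman supergradient); R. B. Griffiths, J. Math. Phys. 5 (1964) 1215;
H. Xu et al., Science 384 (2024) eadh7691, eq. (1) (the `t–t'–U` model); W. Langer, D. Mattis,
Phys. Lett. 36A (1971) 139, eq. (5) (species hopping operators); E. H. Lieb, M. Loss, Duke Math. J. 71
(1993) 337, §8 Thm 8.2 (free-fermion floor); H. Tasaki, Physics and Mathematics of Quantum Many-Body
Systems (2020), §2.1 (variational principle).
-/

noncomputable section

namespace Literature.MathematicalPhysics.QuantumLattice

namespace TTPrimeFree

open Matrix Finset Literature.Probability.LatticeModels LangerMattis FreeKinetic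

variable {L : ℕ}

/-! ### §1 The diagonal hopping operator and the affine structure in `(t', U)` -/

section General

variable {Λ : Type*} [LinearOrder Λ] [Fintype Λ] (G : SimpleGraph Λ) [DecidableRel G.Adj]

/-- At `U = 0` the graph Hamiltonian is `-t` times the spin-summed hopping operator:
`H_G(t,0) = -t (T_↑ + T_↓)`. [cite: LangerMattis1971, eq. (5)] -/
theorem hamiltonian_zero_eq_neg_smul_hopOp (t : ℝ) :
    hamiltonian G t 0 = -(t : ℂ) • (hopOp G 0 + hopOp G 1) := by
  rw [hamiltonian_eq_add_speciesHamiltonian G t 0, speciesHamiltonian, speciesHamiltonian]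
  simp only [zero_div, Complex.ofReal_zero, zero_smul, add_zero, smul_add]

end General

variable (L) in
/-- The **next-nearest-neighbour (diagonal) hopping operator** of the square torus,
`T' = Σ_σ Σ_{x ∼' y} c†_{xσ} c_{yσ}` (both orderings of each diagonal bond, hence Hermitian), so that
the `t'`-term of `H(t,t',U)` is `-t' T'`. [cite: XuEtAl2024, eq. (1)] -/
def diagHop : Matrix (Finset (Orb (FermionTorus 2 L))) (Finset (Orb (FermionTorus 2 L))) ℂ :=
  hopOp (fermionTorusDiagGraph L) 0 + hopOp (fermionTorusDiagGraph L) 1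

/-- `H(t,t₂',U) = H(t,t',U) + (t' - t₂') T'` (the `t'`-term enters linearly). [cite: XuEtAl2024, eq. (1)] -/
theorem hubbardTorusTT'_eq_add_smul_diagHop [NeZero L] (t t' U t₂' : ℝ) :
    hubbardTorusTT' L t t₂' U = hubbardTorusTT' L t t' U + ((t' - t₂' : ℝ) : ℂ) • diagHop L := by
  rw [hubbardTorusTT', hubbardTorusTT', hamiltonian_zero_eq_neg_smul_hopOp (fermionTorusDiagGraph L) t₂',
    hamiltonian_zero_eq_neg_smul_hopOp (fermionTorusDiagGraph L) t', ← diagHop, Complex.ofReal_sub,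
    sub_smul, neg_smul, neg_smul]
  abel

/-- **Affine structure in `(t', U)`**: `H(t,t₂',U₂) = H(t,t',U) + (t' - t₂') T' + (U₂ - U) D`,
`D = Σ_x n_{x↑}n_{x↓}`. [cite: KomaTasaki1994, §1] -/
theorem hubbardTorusTT'_eq_add_smul_add_smul [NeZero L] (t t' U t₂' U₂ : ℝ) :
    hubbardTorusTT' L t t₂' U₂ =
      hubbardTorusTT' L t t' U + ((t' - t₂' : ℝ) : ℂ) • diagHop L +
        ((U₂ - U : ℝ) : ℂ) • ∑ x : FermionTorus 2 L, numberOp x 0 * numberOp x 1 := by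
  rw [hubbardTorusTT'_eq_add_smul t t₂' U U₂, hubbardTorusTT'_eq_add_smul_diagHop t t' U t₂']

/-- At `t = 0`, `U = 0` the `t–t'` Hamiltonian is `-t' T'`. [cite: XuEtAl2024, eq. (1)] -/
theorem hubbardTorusTT'_tzero_Uzero [NeZero L] (t' : ℝ) :
    hubbardTorusTT' L 0 t' 0 = (-(t' : ℂ)) • diagHop L := by
  rw [hubbardTorusTT', hamiltonian_zero_eq_neg_smul_hopOp, hamiltonian_zero_eq_neg_smul_hopOp, ← diagHop]
  simp

/-- At `t₂' = 0` the `t–t'` sector ground energy is the tree's pure-Hubbard object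
`groundEnergyAt (fermionTorusGraph 2 L) t U N` (so `t' = 0` certificates serve as second points). [cite: XuEtAl2024, eq. (1)] -/
theorem groundEnergy_hubbardTorusTT'_tzero (L : ℕ) (t U : ℝ) (N : ℕ) :
    groundEnergy (hubbardTorusTT' L t 0 U) N = groundEnergyAt (fermionTorusGraph 2 L) t U N := by
  rw [hubbardTorusTT'_zero, hubbardTorus, groundEnergyAt]

/-! ### §2 Expectations and the joint supergradient inequality -/

section Supergradient

variable [NeZero L] (t t' U : ℝ)

/-- `Re⟨ψ, H(t,t₂',U₂)ψ⟩ = Re⟨ψ, H(t,t',U)ψ⟩ + (t' - t₂') Re⟨ψ,T'ψ⟩ + (U₂ - U) Re⟨ψ,Dψ⟩` on every state.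
[cite: KomaTasaki1994, §1] -/
theorem re_expect_tt_affine (t₂' U₂ : ℝ) (ψ : Fock (Orb (FermionTorus 2 L))) :
    (expect (hubbardTorusTT' L t t₂' U₂) ψ).re =
      (expect (hubbardTorusTT' L t t' U) ψ).re + (t' - t₂') * (expect (diagHop L) ψ).re +
        (U₂ - U) * (expect (∑ x : FermionTorus 2 L, numberOp x 0 * numberOp x 1) ψ).re := by
  have hadd : ∀ A B : Matrix (Finset (Orb (FermionTorus 2 L))) (Finset (Orb (FermionTorus 2 L))) ℂ,
      expect (A + B) ψ = expect A ψ + expect B ψ := fun A B => by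
    simp [expect, add_mulVec, dotProduct_add]
  have hsmul : ∀ (c : ℂ) (A : Matrix (Finset (Orb (FermionTorus 2 L))) (Finset (Orb (FermionTorus 2 L))) ℂ),
      expect (c • A) ψ = c * expect A ψ := fun c A => by
    simp [expect, smul_mulVec, dotProduct_smul]
  rw [hubbardTorusTT'_eq_add_smul_add_smul t t' U t₂' U₂, hadd, hadd, hsmul, hsmul, Complex.add_re,
    Complex.add_re, Complex.re_ofReal_mul, Complex.re_ofReal_mul]

/-- **Joint supergradient inequality.** For every normalised ground state `ψ` of `H(t,t',U)` in the
`N`-particle sector and every second point `(t₂', U₂)`: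
`E_N(t,t₂',U₂) ≤ E_N(t,t',U) + (t' - t₂')·Re⟨ψ,T'ψ⟩ + (U₂ - U)·⟨ψ,Dψ⟩`
(variational principle at the second point; joint concavity of the ground energy in the linear
couplings). [cite: KomaTasaki1994, §1] -/
theorem groundEnergy_tt_le_affine {N : ℕ} {ψ : Fock (Orb (FermionTorus 2 L))}
    (hψ : IsGroundState (hubbardTorusTT' L t t' U) N ψ) (hψ1 : star ψ ⬝ᵥ ψ = 1) (t₂' U₂ : ℝ) :
    groundEnergy (hubbardTorusTT' L t t₂' U₂) N ≤
      groundEnergy (hubbardTorusTT' L t t' U) N + (t' - t₂') * (expect (diagHop L) ψ).re +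
        (U₂ - U) * (expect (∑ x : FermionTorus 2 L, numberOp x 0 * numberOp x 1) ψ).re := by
  have h := LiebThm1.groundEnergy_le_re_expect (hubbardTorusTT' L t t₂' U₂) hψ.1 hψ1
  rw [re_expect_tt_affine t t' U t₂' U₂, re_expect_of_isGroundState_tt t t' U hψ hψ1] at h
  exact h

/-- **Supporting half-plane of the `(T', D)` region from two energy bounds**: if `E_N(t,t',U) ≤ R` and
`L₂ ≤ E_N(t,t₂',U₂)`, then `(t₂' - t')·Re⟨ψ,T'ψ⟩ + (U - U₂)·⟨ψ,Dψ⟩ ≤ R - L₂` for every normalised ground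
state `ψ` of `H(t,t',U)`. [cite: KomaTasaki1994, §1] -/
theorem joint_le_of_bounds {N : ℕ} {ψ : Fock (Orb (FermionTorus 2 L))}
    (hψ : IsGroundState (hubbardTorusTT' L t t' U) N ψ) (hψ1 : star ψ ⬝ᵥ ψ = 1)
    {t₂' U₂ R L₂ : ℝ} (hR : groundEnergy (hubbardTorusTT' L t t' U) N ≤ R)
    (hL₂ : L₂ ≤ groundEnergy (hubbardTorusTT' L t t₂' U₂) N) :
    (t₂' - t') * (expect (diagHop L) ψ).re +
        (U - U₂) * (expect (∑ x : FermionTorus 2 L, numberOp x 0 * numberOp x 1) ψ).re ≤ R - L₂ := by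
  have h := groundEnergy_tt_le_affine t t' U hψ hψ1 t₂' U₂
  have e : (t₂' - t') * (expect (diagHop L) ψ).re +
      (U - U₂) * (expect (∑ x : FermionTorus 2 L, numberOp x 0 * numberOp x 1) ψ).re =
      -((t' - t₂') * (expect (diagHop L) ψ).re +
        (U₂ - U) * (expect (∑ x : FermionTorus 2 L, numberOp x 0 * numberOp x 1) ψ).re) := by ring
  linarith

/-- **Ceiling on the diagonal hopping amplitude** from an upper bound at `t'` and a lower bound at a
larger `t₂'` (same `U`): `Re⟨ψ,T'ψ⟩ ≤ (R - L₂)/(t₂' - t')` (secant above the supergradient of the concave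
`t' ↦ E_N`). [cite: KomaTasaki1994, §1] -/
theorem diagHop_le_of_bounds {N : ℕ} {ψ : Fock (Orb (FermionTorus 2 L))}
    (hψ : IsGroundState (hubbardTorusTT' L t t' U) N ψ) (hψ1 : star ψ ⬝ᵥ ψ = 1)
    {t₂' R L₂ : ℝ} (ht : t' < t₂') (hR : groundEnergy (hubbardTorusTT' L t t' U) N ≤ R)
    (hL₂ : L₂ ≤ groundEnergy (hubbardTorusTT' L t t₂' U) N) :
    (expect (diagHop L) ψ).re ≤ (R - L₂) / (t₂' - t') := by
  have h := joint_le_of_bounds t t' U hψ hψ1 (t₂' := t₂') (U₂ := U) hR hL₂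
  rw [sub_self, zero_mul, add_zero] at h
  rw [le_div_iff₀ (sub_pos.2 ht), mul_comm]
  exact h

/-- **Floor on the diagonal hopping amplitude** from an upper bound at `t'` and a lower bound at a
smaller `t₂'` (same `U`): `(L₂ - R)/(t' - t₂') ≤ Re⟨ψ,T'ψ⟩`. [cite: KomaTasaki1994, §1] -/
theorem le_diagHop_of_bounds {N : ℕ} {ψ : Fock (Orb (FermionTorus 2 L))}
    (hψ : IsGroundState (hubbardTorusTT' L t t' U) N ψ) (hψ1 : star ψ ⬝ᵥ ψ = 1)
    {t₂' R L₂ : ℝ} (ht : t₂' < t') (hR : groundEnergy (hubbardTorusTT' L t t' U) N ≤ R)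
    (hL₂ : L₂ ≤ groundEnergy (hubbardTorusTT' L t t₂' U) N) :
    (L₂ - R) / (t' - t₂') ≤ (expect (diagHop L) ψ).re := by
  have h := joint_le_of_bounds t t' U hψ hψ1 (t₂' := t₂') (U₂ := U) hR hL₂
  rw [sub_self, zero_mul, add_zero] at h
  rw [div_le_iff₀ (sub_pos.2 ht)]
  have e : (t₂' - t') * (expect (diagHop L) ψ).re = -((expect (diagHop L) ψ).re * (t' - t₂')) := by ring
  linarith

omit [NeZero L] in
/-- **Kinetic bookkeeping**: `Re⟨ψ, H(t,t',0)ψ⟩ = Re⟨ψ, H(t,0,0)ψ⟩ - t'·Re⟨ψ,T'ψ⟩` — the full kinetic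
energy splits into the nearest-neighbour part (the tree's `hubbardTorus 2 L t 0`) and `-t'` times the
diagonal hopping amplitude. [cite: XuEtAl2024, eq. (1)] -/
theorem re_expect_tt_zero_split [NeZero L] (ψ : Fock (Orb (FermionTorus 2 L))) :
    (expect (hubbardTorusTT' L t t' 0) ψ).re =
      (expect (hubbardTorus 2 L t 0) ψ).re - t' * (expect (diagHop L) ψ).re := by
  have h := re_expect_tt_affine (L := L) t 0 0 t' 0 ψ
  rw [hubbardTorusTT'_zero, sub_self, zero_mul, add_zero] at h
  rw [h]
  ring

end Supergradient

/-! ### §3 The a-priori range on the `4 × 4` torus: `|Re⟨ψ,T'ψ⟩| ≤ 16` -/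

/-- The diagonal-band momentum sum of the `4 × 4` torus at `μ = 0`: the sixteen levels
`-s·4 cos k₁ cos k₂` (`s = ±1`) are `∓4` (×2), `±4` (×2), `0` (×12), so `2 Σ_k min(ε_k, 0) = -16`.
[cite: LiebLoss1993, §8, Theorem 8.2] -/
theorem diagMomentumSum_four (s : ℝ) (hs : s = 1 ∨ s = -1) (N : ℕ) :
    0 * (N : ℝ) + 2 * ∑ k : TorusSite 2 4, min (ttBand 4 0 s k - 0) 0 = -16 := by
  set F : ℝ → ℝ → ℝ := fun a b => min (-0 * (2 * (a + b)) + -s * (4 * a * b) - 0) 0 with hF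
  have hs' : ∑ k : TorusSite 2 4, min (ttBand 4 0 s k - 0) 0 =
      ∑ ab : Fin 4 × Fin 4, F (cosFour ab.1.val) (cosFour ab.2.val) := by
    refine Fintype.sum_equiv (piFinTwoEquiv fun _ => ZMod 4) _ _ fun k => ?_
    rw [ttBand_four]
    rfl
  have e11 : F 1 1 + F 1 (-1) = -4 := by
    rcases hs with rfl | rfl
    · simp only [hF]; rw [min_eq_left (by norm_num), min_eq_right (by norm_num)]; norm_num
    · simp only [hF]; rw [min_eq_right (by norm_num), min_eq_left (by norm_num)]; norm_num
  have emm : F (-1) (-1) + F (-1) 1 = -4 := by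
    rcases hs with rfl | rfl
    · simp only [hF]; rw [min_eq_left (by norm_num), min_eq_right (by norm_num)]; norm_num
    · simp only [hF]; rw [min_eq_right (by norm_num), min_eq_left (by norm_num)]; norm_num
  have e10 : F 1 0 = 0 := by simp only [hF]; rw [min_eq_right (by norm_num)]
  have e01 : F 0 1 = 0 := by simp only [hF]; rw [min_eq_right (by norm_num)]
  have e00 : F 0 0 = 0 := by simp only [hF]; rw [min_eq_right (by norm_num)]
  have e0m : F 0 (-1) = 0 := by simp only [hF]; rw [min_eq_right (by norm_num)]
  have em0 : F (-1) 0 = 0 := by simp only [hF]; rw [min_eq_right (by norm_num)]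
  have hv : (0 : Fin 4).val = 0 ∧ (1 : Fin 4).val = 1 ∧ (2 : Fin 4).val = 2 ∧ (3 : Fin 4).val = 3 :=
    ⟨rfl, rfl, rfl, rfl⟩
  have hc : cosFour 0 = 1 ∧ cosFour 1 = 0 ∧ cosFour 2 = -1 ∧ cosFour 3 = 0 := ⟨rfl, rfl, rfl, rfl⟩
  rw [hs', Fintype.sum_prod_type]
  simp only [Fin.sum_univ_four, hv.1, hv.2.1, hv.2.2.1, hv.2.2.2, hc.1, hc.2.1, hc.2.2.1, hc.2.2.2]
  rw [e10, e01, e00, e0m, em0]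
  linarith

/-- The free floor `-16 ≤ E_N(H(0,s,0))` on the `4 × 4` torus for `s = ±1`, i.e. `∓T'` is bounded below
by `-16` on every particle sector. [cite: LiebLoss1993, §8, Theorem 8.2] -/
theorem groundEnergy_hubbardTorusTT'_tzero_four_ge (s : ℝ) (hs : s = 1 ∨ s = -1) {N : ℕ}
    (hN : N ≤ 32) : -16 ≤ groundEnergy (hubbardTorusTT' 4 0 s 0) N := by
  haveI : NeZero (4 : ℕ) := ⟨by norm_num⟩
  have h := le_groundEnergy_hubbardTorusTT' (L := 4) (by norm_num) 0 s (le_refl (0 : ℝ)) 0 (N := N)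
    (by norm_num; omega)
  rw [diagMomentumSum_four s hs N] at h
  exact h

/-- **A-priori range of the diagonal hopping amplitude on the `4 × 4` torus**: for every normalised
`N`-particle state `ψ`, `-16 ≤ Re⟨ψ,T'ψ⟩ ≤ 16` (the free floors of `±T'`; per site `|Re⟨ψ,T'ψ⟩|/16 ≤ 1`).
[cite: LiebLoss1993, §8, Theorem 8.2] -/
theorem diagHop_four_mem_Icc {N : ℕ} (hN : N ≤ 32) {ψ : Fock (Orb (FermionTorus 2 4))}
    (hψN : IsNParticle N ψ) (hψ1 : star ψ ⬝ᵥ ψ = 1) :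
    (expect (diagHop 4) ψ).re ∈ Set.Icc (-16 : ℝ) 16 := by
  haveI : NeZero (4 : ℕ) := ⟨by norm_num⟩
  have hsmul : ∀ (c : ℂ) (A : Matrix (Finset (Orb (FermionTorus 2 4))) (Finset (Orb (FermionTorus 2 4))) ℂ),
      expect (c • A) ψ = c * expect A ψ := fun c A => by
    simp [expect, smul_mulVec, dotProduct_smul]
  have hlo := groundEnergy_hubbardTorusTT'_tzero_four_ge (-1) (Or.inr rfl) hN
  have hhi := groundEnergy_hubbardTorusTT'_tzero_four_ge 1 (Or.inl rfl) hN
  have vlo := LiebThm1.groundEnergy_le_re_expect (hubbardTorusTT' 4 0 (-1) 0) hψN hψ1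
  have vhi := LiebThm1.groundEnergy_le_re_expect (hubbardTorusTT' 4 0 1 0) hψN hψ1
  rw [hubbardTorusTT'_tzero_Uzero, hsmul] at vlo vhi
  rw [hubbardTorusTT'_tzero_Uzero] at hlo hhi
  have elo : ((-((-1 : ℝ) : ℂ)) * expect (diagHop 4) ψ).re = (expect (diagHop 4) ψ).re := by
    push_cast; simp
  have ehi : ((-((1 : ℝ) : ℂ)) * expect (diagHop 4) ψ).re = -(expect (diagHop 4) ψ).re := by
    push_cast; simp
  rw [elo] at vlo
  rw [ehi] at vhi
  constructor <;> linarith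

end TTPrimeFree

end Literature.MathematicalPhysics.QuantumLattice

end
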